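import Summits.BirchSwinnertonDyer.Rank1Residual.X5.TwoAdicTargetsMultEnd
import Summits.BirchSwinnertonDyer.Rank1Residual.X5.TwoAdicMuZeroUpgrade
import Literature.NumberTheory.EllipticCurves.PAdicLFunctionNonsplitMultiplicativeExistenceProofs
import Literature.NumberTheory.EllipticCurves.Greenberg1999.TwoTorsionMuInvariant
import HarnessLib

/-!
# Class O1 (X5, `p = 2`, non-CM): the END-STATE at a NON-SPLIT MULTIPLICATIVE `2`, part 2 — the
# `μ = 0` upgrade for ANY interpolated `L` (PROVED), K11a typed, and the α-ns per-pair consumers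

HONEST FRAMING (cell `b2b-bsdres`, run/shared/lean/b2b/bsd-rank1-residual/, verbatim in every
file): the goal of the cell is to DELETE the COMBINATION-SHAPED residual classes of the
Birch–Swinnerton-Dyer formula for ALL analytic-rank `≤ 1` elliptic curves over `ℚ` — "full BSD
formula for every rank `≤ 1` curve in class `C`" assembled STRICTLY from published theorems — so
that the rank-`≤ 1` remainder becomes exactly the CONSTRUCTION-SHAPED classes, which are TYPED
(missing-input `Prop`s), NOT attempted. This is not "finishing BSD". Research routes; no claim
beyond stated classes; census output = EVIDENCE, never a Literature fact; nothing here is booked;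
no mark of RESIDUAL-MAP §I moves.

Unit `b2b-bsdres-cc-typer-4` (lane CLASS-CLOSURE, class O1), gen 3; o1 lead PLAN v2.6 C53 queue item
(10), part 2 (continues `X5/TwoAdicTargetsMultEnd.lean`). ONE typed target (`@[conjecture] def`,
Summits-side, nothing asserted) + theorems; 0 named facts.

* **`charIdeal_dvd_of_divisibility_of_mu_eq_zero` (PROVED, any prime `p`, any `L`)** — the refuter's
  `μ = 0` upgrade (`MuZeroUpgrade.charIdeal_dvd_of_kato_allPrimes_of_mu_eq_zero`, which is hard-wired
  to `L_p(f, unitRoot)`), generalised to an ARBITRARY power series `L ∈ ℚ_p⟦T⟧`: if `X` is finitely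
  generated torsion with `μ(X) = 0`, `ι g = pⁿ · L` for some `g ∈ char_Λ X` (a `⊗ℚ` divisibility), and
  `ι L₀ = ϖ · L` is an integral normalisation (`ϖ ∈ ℚ`), then `L₀ ∈ char_Λ X`. Same algebra (master
  cancellation + denominator stripping from `X5/TwoAdicMuZeroUpgrade.lean` §1).
* **`O1.KatoDivisibilityAtTwoNonsplitMultRat W f L` (`@[conjecture]`, K11a of lens-3 L3-11
  `TateCurveKatoDivisibilityAtTwo`)** — Kato's `⊗ℚ` divisibility (Thm. 17.4 (1)(2) shape: `X` torsion
  and `ι g = 2ⁿ · L`, `g ∈ char_Λ X`, SOME `n`) at a NON-SPLIT MULTIPLICATIVE `2` for an `L` with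
  `IsMultPAdicLFunctionOf f 2 (-1) L`; no image hypothesis. NOT IN PRINT: Kato's §17 `p`-adic
  `L`-function statements assume `p ∤ N` (Prop. 17.1 / §17.11), the multiplicative cyclotomic
  divisibility is Skinner 2016 Thm. C for ODD `p`. PRICE RELABEL (gen 4; lens-3 GEN 6 G6.1, o1 lead
  PLAN v2.9 C73 (a) ADOPTED, o1 refuter v7 §32 ENDORSED): **AUDIT S–M — Kato §17.13 verbatim `⊗ ℚ`
  under the dictionary `T″ = ℤ₂(φ)`, `φ(Frob₂) = a₂ = −1`**; the gen-3 wording "new mathematics of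
  KNOWN shape, M–L (Kobayashi's Tate-curve Coleman map transposed to `2`)" is WITHDRAWN for the
  non-split case (it survives only for SPLIT `2`, `r ≥ 1`, lens-3 L3-11b). Projection from G1:
  `katoDivisibilityAtTwoNonsplitMultRat_of_upTo` (on `TwoAdicSurjective W`). Nothing asserted.
* **`missingUpperBoundAt_two_nonsplit_of_mu_eq_zero` (PROVED)** — rank `0`, non-split multiplicative
  `2`: K11a for the newform (`hK`) + `μ₂(X) = 0` for the cyclotomic data (`hμ`) + the Néron-integrality
  certificate for the multiplicative `L` (`hint`: `∃ L₀, ι L₀ = ϖ · L`) ⇒ `MissingUpperBoundAt W 2`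
  (SHARP), modulo the analogue of Thm. 4.1 at `2` (`hEC`), modularity, GZK as hypotheses. No image
  hypothesis, no slack, no Cassels–Tate, no period-unit input.
* **`missingUpperBoundAt_two_nonsplit_of_prop514` / `bsdp_two_nonsplit_of_prop514_of_lowerBound`
  (PROVED)** — the α-ns line (85 classes, refuter/lens-1 census, EVIDENCE): `μ = 0 ∧ X` torsion IN
  PRINT from Greenberg Prop. 5.14 at a MULTIPLICATIVE `2` (the literature seat's fact
  `prop514_isTorsion_mu_eq_zero_two`, branch `of_mult`) on a curve with a ramified-XOR-odd rational
  `2`-torsion point; with K11a, `hint`, `hEC`, modularity, GZK ⇒ `MissingUpperBoundAt W 2`; plus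
  `MissingLowerBoundAt W 2` ⇒ `BSDp W 2`. Compared with the α-go line (`X5/TwoAdicTargetsAlphaEnd.lean`)
  the ONE extra unprinted input is K11a (at good `2` its role is played by Kato 17.4 (1)(2), published).

References: [GreenbergLNM1716] §4 pp. 112–113, Prop. 5.14 (p. 121); [Kato2004Asterisque] Thm. 17.4
(p. 273), §17.11; [Skinner2016PacificMC] Thm. C; [Kobayashi2006] (Tate-curve Coleman map, odd `p`);
[MazurTateTeitelbaum1986Invent] §I.10, §I.14; [GreenbergVatsal2000] p. 4; [Miller2011LMS] Def. 1.1.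
-/

set_option autoImplicit false

noncomputable section

open scoped Classical MatrixGroups ModularForm

open CongruenceSubgroup WeierstrassCurve Literature.NumberTheory.EllipticCurves
  Literature.NumberTheory.EllipticCurves.ModularForms
  Literature.NumberTheory.EllipticCurves.Wuthrich2014
  Literature.NumberTheory.EllipticCurves.Rank1Residual
  Literature.NumberTheory.EllipticCurves.Rank1Residual.Typed
  Literature.NumberTheory.EllipticCurves.Greenberg1999
  Summit.BirchSwinnertonDyer.Rank1Residual.X1.MuLambda
  Summit.BirchSwinnertonDyer.Rank1Residual.X1.MuPart

namespace Summit.BirchSwinnertonDyer.Rank1Residual.X5.O1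

variable (W : WeierstrassCurve ℚ) [W.IsElliptic] [W.IsGloballyMinimal]

/-! ## §1 The `μ = 0` upgrade for an arbitrary interpolated `L` (any prime) -/

section AnyPrime

variable (p : ℕ) [Fact p.Prime]

omit [W.IsElliptic] [W.IsGloballyMinimal] in
/-- **A `⊗ℚ` divisibility, pulled back to `Λ`** (any `L`): from `ι g = pⁿ · L` with `g ∈ char_Λ X =
(f_E)` and an integral normalisation `ι L₀ = ϖ · L` (`ϖ ∈ ℚ`):
`(num ϖ · a) · f_E = pⁿ · (den ϖ · L₀)` for some `a ∈ Λ`. (`MuZeroUpgrade.exists_mul_charGen_eq_of_kato_allPrimes`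
with Kato's `L_p(f, α)` replaced by any `L`.) [cite: Kato2004Asterisque, Thm. 17.4 (1)(2) (p. 273) (shape)] -/
theorem exists_mul_charGen_eq_of_divisibility {κ : ZpExtension ℚ p} {γ : Field.absoluteGaloisGroup ℚ}
    (D : W.SelmerDualData κ γ) {fE : IwasawaAlgebra p} (hchar : D.charIdeal = Ideal.span {fE})
    {L : PowerSeries ℚ_[p]}
    (hdiv : ∃ (n : ℕ) (g : IwasawaAlgebra p), g ∈ D.charIdeal ∧
      iwasawaToPowerSeries p g = PowerSeries.C ((p : ℚ_[p]) ^ n) * L)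
    {ϖ : ℚ} {L₀ : IwasawaAlgebra p}
    (hL₀ : iwasawaToPowerSeries p L₀ = PowerSeries.C (ϖ : ℚ_[p]) * L) :
    ∃ (a : IwasawaAlgebra p) (n : ℕ), (PowerSeries.C (ϖ.num : ℤ_[p]) * a) * fE =
      PowerSeries.C ((p : ℤ_[p]) ^ n) * (PowerSeries.C (ϖ.den : ℤ_[p]) * L₀) := by
  obtain ⟨n, g, hg, hι⟩ := hdiv
  rw [hchar] at hg
  obtain ⟨a, ha⟩ := Ideal.mem_span_singleton'.mp hg
  refine ⟨a, n, ?_⟩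
  have hϖd : (ϖ : ℚ_[p]) * (ϖ.den : ℚ_[p]) = (ϖ.num : ℚ_[p]) := by
    have h1 : ((ϖ * ϖ.den : ℚ) : ℚ_[p]) = ((ϖ.num : ℚ) : ℚ_[p]) := by rw [Rat.mul_den_eq_num]
    push_cast at h1
    exact h1
  have hιC : ∀ x : ℤ_[p], iwasawaToPowerSeries p (PowerSeries.C x) = PowerSeries.C (x : ℚ_[p]) :=
    fun x => by rw [iwasawaToPowerSeries, PowerSeries.map_C]; rfl
  apply iwasawaToPowerSeries_injective p
  rw [mul_assoc, ha, map_mul, map_mul, map_mul, hι, hL₀, hιC, hιC, hιC]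
  push_cast
  rw [← hϖd]
  simp only [map_mul, map_pow, map_natCast]
  ring

omit [W.IsGloballyMinimal] in
/-- **`char_Λ X ∣ ϖ · L` in `Λ` from a `⊗ℚ` divisibility and `μ(X) = 0`** (any prime, ANY power
series `L`): `X = X(E/ℚ_∞)` with `μ(X) = 0` (`hμ`) and torsion (`hX`), `ι g = pⁿ · L` for some
`g ∈ char_Λ X` (`hdiv`), `ι L₀ = ϖ · L` integral ⇒ `L₀ ∈ char_Λ X`. Proof = the refuter's
`charIdeal_dvd_of_kato_allPrimes_of_mu_eq_zero` verbatim: `char X = (f_E)` principal, `μ(f_E) = μ(X)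
= 0`, master cancellation of `pⁿ`, denominator stripping of `den ϖ`.
[cite: GreenbergVatsal2000, p. 4 (after Thm. (1.2))] [cite: Kato2004Asterisque, Thm. 17.4 (1)(2) (p. 273) (shape)] -/
theorem charIdeal_dvd_of_divisibility_of_mu_eq_zero {κ : ZpExtension ℚ p}
    {γ : Field.absoluteGaloisGroup ℚ} (hγ : κ.IsTopGenerator γ) (D : W.SelmerDualData κ γ)
    (hX : D.IsTorsion) (hμ : D.mu = 0) {L : PowerSeries ℚ_[p]}
    (hdiv : ∃ (n : ℕ) (g : IwasawaAlgebra p), g ∈ D.charIdeal ∧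
      iwasawaToPowerSeries p g = PowerSeries.C ((p : ℚ_[p]) ^ n) * L)
    {ϖ : ℚ} {L₀ : IwasawaAlgebra p}
    (hL₀ : iwasawaToPowerSeries p L₀ = PowerSeries.C (ϖ : ℚ_[p]) * L) : L₀ ∈ D.charIdeal := by
  haveI : Module.Finite (IwasawaAlgebra p) D.X := D.module_finite_holds hγ
  by_cases hL₀0 : L₀ = 0
  · simp [hL₀0]
  obtain ⟨fE, hfE⟩ := (charIdeal_isPrincipal_holds p D.X).principal
  have hchar : D.charIdeal = Ideal.span {fE} := hfE
  obtain ⟨a, n, hkey⟩ := exists_mul_charGen_eq_of_divisibility W p D hchar hdiv hL₀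
  have hfE0 : fE ≠ 0 := by
    rintro rfl
    rw [mul_zero] at hkey
    exact mul_ne_zero (C_pow_ne_zero n)
      (mul_ne_zero (fun h0 => ϖ.den_nz (by exact_mod_cast (PowerSeries.C_injective
        (h0.trans (map_zero _).symm) : ((ϖ.den : ℕ) : ℤ_[p]) = 0))) hL₀0) hkey.symm
  have hμfE : mu fE = 0 := by
    rw [mu_generator_eq_muInvariant D.X hX hfE0 hchar]; exact hμ
  rw [hchar]
  have hdL : PowerSeries.C (ϖ.den : ℤ_[p]) * L₀ ∈ Ideal.span {fE} :=
    MuZeroUpgrade.mem_span_singleton_of_mul_eq_C_pow_mul hfE0 hμfE hkey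
  exact MuZeroUpgrade.mem_span_of_C_natCast_mul_mem_span hfE0 ϖ.den_nz (hμfE ▸ Nat.zero_le _) hdL

end AnyPrime

/-! ## §2 K11a — Kato's `⊗ℚ` divisibility at a NON-SPLIT multiplicative `2` (typed target) -/

/-- **K11a (lens-3 L3-11 `TateCurveKatoDivisibilityAtTwo`, ROUTES-O1 §lens-3 GEN 4) — Kato's `⊗ℚ`
divisibility at a NON-SPLIT MULTIPLICATIVE `2`.** For `E/ℚ` (globally minimal `W`) with non-split
multiplicative reduction at `2`, the cyclotomic `ℤ₂`-extension with a matching generator, the newform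
`f` and a `2`-adic `L`-function `L` of `f` at the multiplicative prime with `α = a₂ = −1`
(`IsMultPAdicLFunctionOf f 2 (-1) L`): for every dual datum `D`, `X(E/ℚ_∞)` is `Λ`-torsion and
`2ⁿ · L = ι g` for some `g ∈ char_Λ X` and SOME `n` — Kato's Thm. 17.4 (1)(2) with "good ordinary"
replaced by "non-split multiplicative"; NO image hypothesis, `n` unbounded (the integral version with
`n ≤ k` on the full-image locus is G1 `O1.KatoDivisibilityAtTwoMultUpTo`,
`katoDivisibilityAtTwoNonsplitMultRat_of_upTo`). NOT IN PRINT at `2` (nor, in this currency, at odd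
`p` inside Kato 2004: Prop. 17.1 / §17.11–17.13 assume `p ∤ N`; the multiplicative cyclotomic
divisibility at ODD `p ‖ N` is Skinner 2016 Thm. C). **PRICE (relabel, gen 4 — lens-3 GEN 6 G6.1
"K11a by dictionary", o1 lead PLAN v2.9 C73 (a) ADOPTED, o1 refuter v7 §32 ENDORSED): AUDIT S–M —
Kato's §17.13 proof read VERBATIM `⊗ ℚ` under the dictionary `T″ = ℤ₂(φ)`, `φ` the unramified
quadratic character of `ℚ₂`, `φ(Frob₂) = a₂ = −1`** (Tate filtration `0 → ℤ₂(1)(φ) → T₂E → ℤ₂(φ) → 0`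
in place of the ordinary filtration; Lemma 17.12's hypotheses — `T″` unramified, `H⁰(ℚ₂, T″) = 0`,
`Coker(Frob₂ − 1 ∣ T″)` finite — hold because `φ(Frob₂) = −1 ≠ 1`; every `2`-specific defect
(`{±1} ⊂ U¹`, `H⁰(ℚ₂(ζ_{2^∞}), (ℚ₂/ℤ₂)(φ)) = ℤ/2`, `Coker(Frob − 1) = ℤ/2`) is `2`-torsion, hence
invisible in this `⊗ ℚ` statement; Kato's interpolation at `p ∣ N` uses `ε(p) = 0` (§16, Thm. 16.2 /
16.6 — refuter: joint J-K1 IN PRINT); printed odd-`p` warrant for the reading: Wuthrich 2014 §3.2 "the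
same proof also applies when the reduction is non-split multiplicative", Thm. 16 / Cor. 19). The gen-3
wording of this docstring — "the missing piece is the local Coleman map for the Tate curve at `2`,
Kobayashi 2006 transposed, new mathematics of KNOWN shape" — is WITHDRAWN for the NON-SPLIT case; it
survives only for SPLIT multiplicative `2` at analytic rank `≥ 1` (lens-3 L3-11b). Still NOT a
published theorem at `2`: a TARGET; nothing asserted.
[cite: Kato2004Asterisque, Thm. 17.4 (1)(2) (p. 273), §17.11–17.13 with Lemma 17.12 (held copy `paper:doi-10-24033-ast-639` p0157 L33–L34, p0162 L56–L60, p0164 L9–L24), §16 (ε(ℓ) = 0 for ℓ ∣ N, p0046 L9) (shape and proof text only; p ∤ N in print)]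
[cite: Skinner2016PacificMC, Thm. C (odd p; shape only)]
[cite: Wuthrich2014, §3.2 and Thm. 16 / Cor. 19 (odd p, semistable; held copy `paper:doi-10-4171-dm-450` p0011, p0013–p0014)] -/
@[conjecture] def KatoDivisibilityAtTwoNonsplitMultRat {N : ℕ} [NeZero N] (f : CuspForm (Gamma0 N) 2)
    (L : PowerSeries ℚ_[2]) : Prop :=
  ∀ (κ : ZpExtension ℚ 2) (γ : Field.absoluteGaloisGroup ℚ), κ.IsCyclotomic →
    κ.IsTopGenerator γ → IsCyclotomicVariable 2 γ → Mult W 2 →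
    ¬ W.HasSplitMultiplicativeReductionAtPrime 2 →
    IsNewformOf W f → IsMultPAdicLFunctionOf f 2 (-1) L →
    ∀ D : W.SelmerDualData κ γ, D.IsTorsion ∧
      ∃ (n : ℕ) (g : IwasawaAlgebra 2), g ∈ D.charIdeal ∧
        iwasawaToPowerSeries 2 g = PowerSeries.C ((2 : ℚ_[2]) ^ n) * L

omit [W.IsElliptic] [W.IsGloballyMinimal] in
/-- G1 (integral up to `2^k`, on `ρ_{E,2^∞}` surjective) implies K11a on the full-image locus.
Bookkeeping. [folklore] -/
theorem katoDivisibilityAtTwoNonsplitMultRat_of_upTo {N : ℕ} [NeZero N] {f : CuspForm (Gamma0 N) 2}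
    {L : PowerSeries ℚ_[2]} {k : ℕ} (h : KatoDivisibilityAtTwoMultUpTo W k f (-1) L)
    (him : TwoAdicSurjective W) : KatoDivisibilityAtTwoNonsplitMultRat W f L := by
  intro κ γ hκ hγ hγ' hmult hns hf hLf D
  obtain ⟨hX, n, g, -, hg, hι⟩ := h κ γ hκ hγ hγ' hmult (Or.inr ⟨hns, rfl⟩) hf hLf him D
  exact ⟨hX, n, g, hg, hι⟩

omit [W.IsElliptic] [W.IsGloballyMinimal] in
/-- Off the non-split multiplicative locus K11a holds VACUOUSLY (its guards). [folklore] -/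
theorem katoDivisibilityAtTwoNonsplitMultRat_of_not_mult {N : ℕ} [NeZero N]
    (f : CuspForm (Gamma0 N) 2) (L : PowerSeries ℚ_[2]) (h : ¬ Mult W 2) :
    KatoDivisibilityAtTwoNonsplitMultRat W f L :=
  fun _ _ _ _ _ hm => absurd hm h

/-! ## §3 Per-pair consumers at a non-split multiplicative `2`: `μ = 0` + K11a + certificates -/

/-- **`MissingUpperBoundAt W 2` at a NON-SPLIT MULTIPLICATIVE `2` from `μ₂(X) = 0` (PROVED, per curve,
SHARP).** Rank `0` (`hr`), non-split multiplicative `2` (`hmult`, `hns`); the typed/published inputs as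
hypotheses: the analogue of Thm. 4.1 at `2` (`hEC`, print as a display), modularity (`hmod`), GZK
(`hGZK`), K11a for the newform at level `N_E` (`hK`, NOT in print); the research/certificate inputs:
`μ = 0` for the cyclotomic data (`hμ`; on the Prop. 5.14 locus this is PRINT —
`missingUpperBoundAt_two_nonsplit_of_prop514`) and integrality of the NÉRON-normalised multiplicative
`2`-adic `L`-function `ϖ · L ∈ Λ` (`hint`, per-curve certificate, EVIDENCE per row). No image
hypothesis, no period-unit input, no slack. [cite: GreenbergLNM1716, §4 pp. 112–113]
[cite: MazurTateTeitelbaum1986Invent, §I.10 and §I.14] [cite: Miller2011LMS, Def. 1.1] -/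
theorem missingUpperBoundAt_two_nonsplit_of_mu_eq_zero (hEC : TwoAdicEulerCharRankZeroNonsplitMult W 0)
    (hmod : nonempty_modularParametrizationData)
    (hGZK : rank_eq_analyticRank_of_analyticRank_le_one)
    (hK : ∀ [NeZero (W.conductorNorm ℤ)] (f : CuspForm (Gamma0 (W.conductorNorm ℤ)) 2)
      (L : PowerSeries ℚ_[2]), KatoDivisibilityAtTwoNonsplitMultRat W f L)
    (hμ : ∀ (κ : ZpExtension ℚ 2) (γ : Field.absoluteGaloisGroup ℚ), κ.IsCyclotomic →
      κ.IsTopGenerator γ → IsCyclotomicVariable 2 γ → ∀ D : W.SelmerDualData κ γ, D.mu = 0)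
    (hint : ∀ [NeZero (W.conductorNorm ℤ)] (f : CuspForm (Gamma0 (W.conductorNorm ℤ)) 2),
      IsNewformOf W f → ∀ ϖ : ℚ, (ϖ : ℝ) * W.realPeriodRat = plusPeriod f →
      ∀ L : PowerSeries ℚ_[2], IsMultPAdicLFunctionOf f 2 (-1) L →
        ∃ L₀ : IwasawaAlgebra 2, iwasawaToPowerSeries 2 L₀ = PowerSeries.C (ϖ : ℚ_[2]) * L)
    (hr : W.analyticRank = 0) (hmult : Mult W 2)
    (hns : ¬ W.HasSplitMultiplicativeReductionAtPrime 2) : MissingUpperBoundAt W 2 := by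
  haveI : NeZero (W.conductorNorm ℤ) := ⟨(W.conductorNorm_pos_holds).ne'⟩
  obtain ⟨Dm⟩ := hmod W
  have hf : IsNewformOf W Dm.f := Dm.isNewformOf
  have hL : W.entireLFunction 1 ≠ 0 :=
    (W.analyticRank_eq_zero_iff_holds hf.hasEntireLFunction).mp hr
  obtain ⟨ϖ, hϖpos, hϖeq, -⟩ := Dm.exists_rat_mul_realPeriodRat_eq_plusPeriod
  obtain ⟨κ, hκ, γ, hγ, hγ'⟩ := exists_isCyclotomic_isTopGenerator_isCyclotomicVariable_holds 2
  obtain ⟨D⟩ := W.nonempty_selmerDualData_holds κ γ hγ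
  obtain ⟨L, hLf⟩ := exists_isMultPAdicLFunctionOf_neg_one_of_nonsplit hf hmult hns
  obtain ⟨hX, n, g, hg, hι⟩ := hK Dm.f L κ γ hκ hγ hγ' hmult hns hf hLf D
  obtain ⟨L₀, hL₀⟩ := hint Dm.f hf ϖ hϖeq L hLf
  have hmem : L₀ ∈ D.charIdeal :=
    charIdeal_dvd_of_divisibility_of_mu_eq_zero W 2 hγ D hX (hμ κ γ hκ hγ hγ' D) ⟨n, g, hg, hι⟩ hL₀
  obtain ⟨q, hq, hle⟩ := upperBound_two_nonsplit_of_divisibilityRat W hEC hGZK hmult hns hL hκ hγ hγ'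
    hf hLf D ϖ hϖeq hϖpos.ne' 0 (by simp) ⟨hX, L₀, hmem, hL₀⟩
  exact ⟨q, hq, by simpa using hle⟩

/-- **`BSD(E,2)` at a non-split multiplicative `2` from `μ = 0`, K11a and the lower half (PROVED).**
`missingUpperBoundAt_two_nonsplit_of_mu_eq_zero` + `MissingLowerBoundAt W 2` ⇒ `MissingPPartAt W 2`
⇒ `BSDp W 2` (GZK). [cite: Miller2011LMS, Def. 1.1 and §1] -/
theorem bsdp_two_nonsplit_of_mu_eq_zero_of_lowerBound (hEC : TwoAdicEulerCharRankZeroNonsplitMult W 0)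
    (hmod : nonempty_modularParametrizationData)
    (hGZK : rank_eq_analyticRank_of_analyticRank_le_one)
    (hK : ∀ [NeZero (W.conductorNorm ℤ)] (f : CuspForm (Gamma0 (W.conductorNorm ℤ)) 2)
      (L : PowerSeries ℚ_[2]), KatoDivisibilityAtTwoNonsplitMultRat W f L)
    (hμ : ∀ (κ : ZpExtension ℚ 2) (γ : Field.absoluteGaloisGroup ℚ), κ.IsCyclotomic →
      κ.IsTopGenerator γ → IsCyclotomicVariable 2 γ → ∀ D : W.SelmerDualData κ γ, D.mu = 0)
    (hint : ∀ [NeZero (W.conductorNorm ℤ)] (f : CuspForm (Gamma0 (W.conductorNorm ℤ)) 2),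
      IsNewformOf W f → ∀ ϖ : ℚ, (ϖ : ℝ) * W.realPeriodRat = plusPeriod f →
      ∀ L : PowerSeries ℚ_[2], IsMultPAdicLFunctionOf f 2 (-1) L →
        ∃ L₀ : IwasawaAlgebra 2, iwasawaToPowerSeries 2 L₀ = PowerSeries.C (ϖ : ℚ_[2]) * L)
    (hr : W.analyticRank = 0) (hmult : Mult W 2)
    (hns : ¬ W.HasSplitMultiplicativeReductionAtPrime 2) (hlow : MissingLowerBoundAt W 2) :
    BSDp W 2 :=
  bsdp_of_missingPPartAt W 2 hGZK (by rw [hr]; exact zero_le_one)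
    (missingPPartAt_of_lower_of_upper W 2 hlow
      (missingUpperBoundAt_two_nonsplit_of_mu_eq_zero W hEC hmod hGZK hK hμ hint hr hmult hns))

/-- **α-ns: `MissingUpperBoundAt W 2` on the Greenberg Prop. 5.14 locus at a NON-SPLIT
MULTIPLICATIVE `2` (PROVED modulo the typed/published inputs and ONE certificate).** Rank `0`,
non-split multiplicative `2`, a rational point `(x, y)` of order `2` that is ramified-at-`2` XOR odd;
`μ = 0` ∧ `X` torsion IN PRINT (`h514`, the literature seat's `prop514_isTorsion_mu_eq_zero_two`,
multiplicative branch `of_mult` — Prop. 5.14 is stated for "good, ordinary or multiplicative reduction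
at 2"); K11a (`hK`, NOT in print); the analogue of Thm. 4.1 at `2` (`hEC`), modularity, GZK; the
Néron-integrality certificate (`hint`). The refuter's α-ns line (85 non-split r0 residue classes with
such a member, census `O1D-GREENBERG-L1.tsv`, EVIDENCE).
[cite: GreenbergLNM1716, Prop. 5.14 (p. 121) and §4 pp. 112–113] [cite: Miller2011LMS, Def. 1.1] -/
theorem missingUpperBoundAt_two_nonsplit_of_prop514 (h514 : prop514_isTorsion_mu_eq_zero_two)
    (hEC : TwoAdicEulerCharRankZeroNonsplitMult W 0) (hmod : nonempty_modularParametrizationData)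
    (hGZK : rank_eq_analyticRank_of_analyticRank_le_one)
    (hK : ∀ [NeZero (W.conductorNorm ℤ)] (f : CuspForm (Gamma0 (W.conductorNorm ℤ)) 2)
      (L : PowerSeries ℚ_[2]), KatoDivisibilityAtTwoNonsplitMultRat W f L)
    (hint : ∀ [NeZero (W.conductorNorm ℤ)] (f : CuspForm (Gamma0 (W.conductorNorm ℤ)) 2),
      IsNewformOf W f → ∀ ϖ : ℚ, (ϖ : ℝ) * W.realPeriodRat = plusPeriod f →
      ∀ L : PowerSeries ℚ_[2], IsMultPAdicLFunctionOf f 2 (-1) L →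
        ∃ L₀ : IwasawaAlgebra 2, iwasawaToPowerSeries 2 L₀ = PowerSeries.C (ϖ : ℚ_[2]) * L)
    (hr : W.analyticRank = 0) (hmult : Mult W 2) (hns : ¬ W.HasSplitMultiplicativeReductionAtPrime 2)
    {x y : ℚ} (hP : W.toAffine.Equation x y) (h2 : 2 * y + W.a₁ * x + W.a₃ = 0)
    (hΦ : (TwoTorsionRamifiedAtTwo x ∧ ¬ TwoTorsionOdd W x) ∨
      (TwoTorsionOdd W x ∧ ¬ TwoTorsionRamifiedAtTwo x)) : MissingUpperBoundAt W 2 :=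
  missingUpperBoundAt_two_nonsplit_of_mu_eq_zero W hEC hmod hGZK hK
    (fun _ _ hκ hγ _ D => (h514.of_mult W hmult hP h2 hΦ hκ hγ D).2) hint hr hmult hns

/-- **α-ns END-STATE per pair: `BSD(E,2)` on the Prop. 5.14 locus at a non-split multiplicative `2`
from the lower half (PROVED).** `missingUpperBoundAt_two_nonsplit_of_prop514` + `MissingLowerBoundAt
W 2` (per pair an exact `2^∞`-descent certificate; per class the Eisenstein half) ⇒ `BSDp W 2`. What
is NOT a published theorem among the inputs: K11a (`hK`), the `δ = 0` reading of the display at `2`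
(`hEC`, cite-audit), and the two certificates. One member per isogeny class suffices
(`bsdp_two_iff_of_isIsogenous`). Nothing is booked. [cite: GreenbergLNM1716, Prop. 5.14 (p. 121)]
[cite: Miller2011LMS, Def. 1.1 and §1] -/
theorem bsdp_two_nonsplit_of_prop514_of_lowerBound (h514 : prop514_isTorsion_mu_eq_zero_two)
    (hEC : TwoAdicEulerCharRankZeroNonsplitMult W 0) (hmod : nonempty_modularParametrizationData)
    (hGZK : rank_eq_analyticRank_of_analyticRank_le_one)
    (hK : ∀ [NeZero (W.conductorNorm ℤ)] (f : CuspForm (Gamma0 (W.conductorNorm ℤ)) 2)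
      (L : PowerSeries ℚ_[2]), KatoDivisibilityAtTwoNonsplitMultRat W f L)
    (hint : ∀ [NeZero (W.conductorNorm ℤ)] (f : CuspForm (Gamma0 (W.conductorNorm ℤ)) 2),
      IsNewformOf W f → ∀ ϖ : ℚ, (ϖ : ℝ) * W.realPeriodRat = plusPeriod f →
      ∀ L : PowerSeries ℚ_[2], IsMultPAdicLFunctionOf f 2 (-1) L →
        ∃ L₀ : IwasawaAlgebra 2, iwasawaToPowerSeries 2 L₀ = PowerSeries.C (ϖ : ℚ_[2]) * L)
    (hr : W.analyticRank = 0) (hmult : Mult W 2) (hns : ¬ W.HasSplitMultiplicativeReductionAtPrime 2)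
    {x y : ℚ} (hP : W.toAffine.Equation x y) (h2 : 2 * y + W.a₁ * x + W.a₃ = 0)
    (hΦ : (TwoTorsionRamifiedAtTwo x ∧ ¬ TwoTorsionOdd W x) ∨
      (TwoTorsionOdd W x ∧ ¬ TwoTorsionRamifiedAtTwo x))
    (hlow : MissingLowerBoundAt W 2) : BSDp W 2 :=
  bsdp_of_missingPPartAt W 2 hGZK (by rw [hr]; exact zero_le_one)
    (missingPPartAt_of_lower_of_upper W 2 hlow
      (missingUpperBoundAt_two_nonsplit_of_prop514 W h514 hEC hmod hGZK hK hint hr hmult hns hP h2 hΦ))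

end Summit.BirchSwinnertonDyer.Rank1Residual.X5.O1
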